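import Summits.CriticalPhenomena.PercolationContinuityZ3.Theorems.PercNearOneGluingNoHeavyLowerTailHybridThreePointLB
import Summits.CriticalPhenomena.PercolationContinuityZ3.Theorems.PercNearOneGluingNoHeavyLowerTailE3GroupSepOfSahi
import Summits.CriticalPhenomena.PercolationContinuityZ3.Theorems.PercNearOneGluingNoHeavyLowerTailGroupSepHybridRows
import Summits.CriticalPhenomena.PercolationContinuityZ3.Theorems.PercNearOneGluingNoHeavyLowerTailGroupThreePointLBRows
import Summits.CriticalPhenomena.PercolationContinuityZ3.Theorems.PercNearOneGluingNoHeavyLowerTailE3GroupSepHybridRows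
import Literature.Probability.Percolation.KozmaNitzanHittable
import HarnessLib

/-!
# `NoHeavyLowerTail` (stmt-CriticalPhenomena-4575) — the measure-level hybrid row `HybridSepRow` (`E1 = hybE`) is a THEOREM, and all
# four decreasing E3GRP rows hold on EVERY finite weighted graph (package): corollaries of the hybrid/group three-point lower bound

Support file (prover prim-ineq-gen-8; `--supports stmt-CriticalPhenomena-4575`).  No named facts, no sorries, no definitions.

prim-ineq-gen-8's THEOREM (HYBRID/GROUP 3PT-LB, THEOREM-HYBRID-3PTLB.md, 2026-08-19; in the tree as prim-cert-2's
`HybridThreePointLB.sahiE3_hybrid_nonneg`): for a vertex `c` and vertex sets `P₁`, `P₃ ⊆ P₃′`,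
`0 ≤ E₃({P₁ ≁ c}, {c ≁ P₃}, {P₁ ≁ P₃′})`.  Here its named instances are discharged:
* `hybridSepRow_holds : HybridSepRow` — **(E1)** `0 ≤ E₃({b↮c},{a↮c},{b↮a}∩{b↮y})` for every finite weighted graph
  and all `a b c y` (the hybrid group-separation row of the SHK3⁺ terminal-edge step, `…GroupSepHybridRows`, previously
  `@[conjecture]`/OPEN, consumed by the slice certificate `CubicThreePointStep.bernstein_nonneg_slice`): `P₁={b}`, `P₃={a}`, `P₃′={a,y}`.
* `e3Ineq_hybrid` — the theorem in the `E3Ineq`/`sep` dictionary of `…E3GroupSepLeFive` for arbitrary terminal LISTS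
  `P₁`, `P₃ ⊆ P₃'` and a vertex `c`; and `rowHolds_dec` — all four DEcreasing E3GRP rows `RowHolds i`, `i ≤ 3`, for every `n`,
  `w`, tuple, packaged from prim-ineq-prove-3's `rowHolds_zero/one/two_all` (group triangles, `…GroupThreePointLBRows`) and
  prim-cert-2's `rowHolds_three_all` (the `|A| = 5` row `r3`, `…E3GroupSepHybridRows`).
The five INcreasing rows `i = 4…8` are not of this shape and remain conditional (`rowHolds_of_kahnConjecture`).
-/

noncomputable section

namespace Summit.CriticalPhenomena.PercolationContinuityZ3.Theorems

open MeasureTheory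
open Literature.Probability.LatticeModels (prodBernoulli sahiE3 sahiE3_def)
open Literature.Probability.Percolation

/-! ### (E1) the hybrid group-separation row -/

/-- **(E1) = `hybE ≥ 0` holds on every finite weighted graph**: `HybridSepRow` (the hybrid group-separation
Richards–Sahi row of the SHK3⁺ terminal-edge step) is a theorem — the instance `P₁ = {b}`, `c`, `P₃ = {a} ⊆ P₃′ = {a,y}`
of the hybrid/group three-point lower bound.  Source: prim-ineq-gen-8, THEOREM-HYBRID-3PTLB.md (2026-08-19). [folklore] -/
theorem hybridSepRow_holds : HybridSepRow := by
  intro V _ w a b c y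
  classical
  have h := HybridThreePointLB.sahiE3_hybrid_nonneg w c ({b} : Finset V) ({a} : Finset V) ({a, y} : Finset V)
    (by simp)
  have s1 : {ω : BondConfig V | ∀ u ∈ ({b} : Finset V), ω ∉ openConn c u} = (openConn b c)ᶜ := by
    ext ω
    simp only [Finset.mem_singleton, forall_eq, Set.mem_setOf_eq, Set.mem_compl_iff, openConn_comm b c]
  have s2 : {ω : BondConfig V | ∀ v ∈ ({a} : Finset V), ω ∉ openConn c v} = (openConn a c)ᶜ := by
    ext ω
    simp only [Finset.mem_singleton, forall_eq, Set.mem_setOf_eq, Set.mem_compl_iff, openConn_comm a c]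
  have s3 : {ω : BondConfig V | ∀ v ∈ ({a, y} : Finset V), ∀ u ∈ ({b} : Finset V), ω ∉ openConn v u} =
      (openConn b a)ᶜ ∩ (openConn b y)ᶜ := by
    ext ω
    simp only [Finset.mem_insert, Finset.mem_singleton, forall_eq_or_imp, forall_eq, Set.mem_setOf_eq,
      Set.mem_inter_iff, Set.mem_compl_iff, openConn_comm b a, openConn_comm b y]
  rw [s1, s2, s3] at h
  exact h

/-! ### The four decreasing E3GRP rows, every `n`, every weighting, every terminal tuple -/

namespace E3GroupSepCert

open CovTransferCert Literature.Combinatorics.Sahi2008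

variable {n : ℕ}

/-- **The hybrid/group bound in the `E3Ineq` dictionary**: for a vertex `c` and terminal lists `P₁`, `P₃ ⊆ P₃'`,
`E3Ineq w (sep [c] P₁) (sep [c] P₃) (sep P₃' P₁)`. [folklore] -/
theorem e3Ineq_hybrid (w : Sym2 (Fin n) → unitInterval) (c : Fin n) (P₁ P₃ P₃' : List (Fin n))
    (hP : ∀ v ∈ P₃, v ∈ P₃') : E3Ineq w (sep [c] P₁) (sep [c] P₃) (sep P₃' P₁) := by
  classical
  rw [e3Ineq_iff_sahiE3_nonneg, connEvent_sep, connEvent_sep, connEvent_sep]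
  have h := HybridThreePointLB.sahiE3_hybrid_nonneg w c P₁.toFinset P₃.toFinset P₃'.toFinset
    (fun v hv => List.mem_toFinset.2 (hP v (List.mem_toFinset.1 hv)))
  have s1 : {ω : BondConfig (Fin n) | ∀ u ∈ P₁.toFinset, ω ∉ openConn c u} =
      {ω | ∀ x ∈ [c], ∀ y ∈ P₁, ω ∉ openConn x y} := by
    ext ω; simp only [List.mem_toFinset, Set.mem_setOf_eq, List.mem_singleton, forall_eq]
  have s2 : {ω : BondConfig (Fin n) | ∀ v ∈ P₃.toFinset, ω ∉ openConn c v} =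
      {ω | ∀ x ∈ [c], ∀ y ∈ P₃, ω ∉ openConn x y} := by
    ext ω; simp only [List.mem_toFinset, Set.mem_setOf_eq, List.mem_singleton, forall_eq]
  have s3 : {ω : BondConfig (Fin n) | ∀ v ∈ P₃'.toFinset, ∀ u ∈ P₁.toFinset, ω ∉ openConn v u} =
      {ω | ∀ x ∈ P₃', ∀ y ∈ P₁, ω ∉ openConn x y} := by
    ext ω; simp only [List.mem_toFinset, Set.mem_setOf_eq]
  rw [s1, s2, s3] at h
  exact h

/-- **All four decreasing E3GRP rows hold unconditionally** on every finite weighted graph and every terminal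
tuple. [folklore] -/
theorem rowHolds_dec (i : Fin 9) (hi : i.val ≤ 3) (w : Sym2 (Fin n) → unitInterval) (t : Tup n) : RowHolds i w t := by
  obtain ⟨o, a₁, a₂, a₃, b⟩ := t
  fin_cases i
  · exact rowHolds_zero_all w o a₁ a₂ a₃ b
  · exact rowHolds_one_all w o a₁ a₂ a₃ b
  · exact rowHolds_two_all w o a₁ a₂ a₃ b
  · exact rowHolds_three_all w (o, a₁, a₂, a₃, b)
  all_goals (exfalso; simp at hi)

end E3GroupSepCert

end Summit.CriticalPhenomena.PercolationContinuityZ3.Theorems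

end
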